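import Summits.MatrixMultiplication.MatrixMultiplication.Theorems.SoloInformedTranslationSchemes
import HarnessLib

/-!
# Few-multiplier TPP stability, II: twisted realizations and the five-term lemma

Solo-informed seat (MatrixMultiplication), gen 104; dossier `paper/theoremB2.md` §7 (Theorem C2),
steps (0)–(2).

`TwistedRealization A S I J K` packages the data of part I: an abelian MULTIPLIER GROUP `A` (written
additively; `A = Additive M₀` for a translation scheme `𝒮(S, M₀)`, Cohn–Umans 2013 §5) acting on the
finite abelian group `S` by `sm : A → (S →+ S)`, orbit representatives `a, b, d` of a realization of
`⟨|I|,|J|,|K|⟩` (CU13 Def. 12) with a pattern `(φ, ψ)` solving the matrix-multiplication equations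
`a i j + sm (φ i j k) (b j k) + sm (ψ i j k) (d k i) = 0`, and the global half of the realization
property. `rotate` is the cyclic symmetry `(a, b, d; I, J, K) ↦ (b, d, a; J, K, I)`.

`card_bad_slices_le` (the FIVE-TERM LEMMA): if `A` acts fixed-point-freely (`sm g x = x, g ≠ 0 ⟹
x = 0`), then for every rectangle `{i,i'} × {k,k'}` the number of slices `j` on which the HOLONOMY
`φ i j k - φ i j k' - φ i' j k + φ i' j k'` is non-zero is at most `|A|⁵`: eliminating `a i j, a i' j,
b j k` from the four equations of the rectangle gives
`sm hol (b j k') - b j k' = -sm μ₁ (d k i) + sm μ₂ (d k' i) + sm μ₃ (d k i') - sm μ₄ (d k' i')`,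
so `j ↦ (hol, μ₁, …, μ₄) ∈ A⁵` is injective on bad slices (fixed-point-freeness, then the realization
property). `card_bad_slices_le_psi/theta` are the rotated forms for the `ψ`- and `(ψ-φ)`-slices.
References: CohnUmans2013 (arXiv:1207.6528) Def. 12, §5, Conj. 21; this work (Theorem C2).
-/

noncomputable section

open scoped BigOperators
open Finset

namespace Summit.MatrixMultiplication.MatrixMultiplication.Theorems.TwistedTPP

/-- Orbit representatives and a pattern of a realization of `⟨|I|,|J|,|K|⟩` in a translation scheme
with abelian multiplier group `A` (additive) acting on `S` via `sm` (module docstring). [CU13 Def. 12;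
this work] -/
structure TwistedRealization (A S I J K : Type*) [AddCommGroup A] [AddCommGroup S] where
  /-- the action of the multiplier group by additive endomorphisms (automorphisms) of `S` -/
  sm : A → S →+ S
  sm_add : ∀ (g h : A) (x : S), sm (g + h) x = sm g (sm h x)
  sm_zero : ∀ x : S, sm 0 x = x
  /-- orbit representatives of the three class maps -/
  a : I → J → S
  b : J → K → S
  d : K → I → S
  /-- the pattern: multipliers solving the matrix-multiplication equations -/
  φ : I → J → K → A
  ψ : I → J → K → A
  eqn : ∀ (i : I) (j : J) (k : K), a i j + sm (φ i j k) (b j k) + sm (ψ i j k) (d k i) = 0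
  /-- the global half of the realization property: only matrix-multiplication triples are twisted
  triangles -/
  real : ∀ (i : I) (j : J) (k : K) (i' : I) (j' : J) (k' : K) (μ ν : A),
    a i j + sm μ (b j' k) + sm ν (d k' i') = 0 → i' = i ∧ j' = j ∧ k' = k

namespace TwistedRealization

variable {A S I J K : Type*} [AddCommGroup A] [AddCommGroup S] (R : TwistedRealization A S I J K)

/-- Transport of a matrix-multiplication equation by a multiplier `g`. -/
theorem transport (g : A) (i : I) (j : J) (k : K) (μ₁ μ₂ : A) (h1 : μ₁ = g + R.φ i j k)
    (h2 : μ₂ = g + R.ψ i j k) :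
    R.sm g (R.a i j) + R.sm μ₁ (R.b j k) + R.sm μ₂ (R.d k i) = 0 := by
  subst h1 h2
  have e := congrArg (R.sm g) (R.eqn i j k)
  rwa [map_add, map_add, map_zero, ← R.sm_add, ← R.sm_add] at e

/-- **Cyclic symmetry** `(a, b, d; I, J, K) ↦ (b, d, a; J, K, I)` with pattern `(ψ - φ, -φ)`.
[CU13 Def. 12 is cyclically symmetric; this work, Thm C2 (2ψ)/(2ϑ)] -/
def rotate : TwistedRealization A S J K I where
  sm := R.sm
  sm_add := R.sm_add
  sm_zero := R.sm_zero
  a := R.b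
  b := R.d
  d := R.a
  φ := fun j k i => R.ψ i j k - R.φ i j k
  ψ := fun j k i => -R.φ i j k
  eqn := fun j k i => by
    have t := R.transport (-R.φ i j k) i j k 0 (R.ψ i j k - R.φ i j k) (by abel) (by abel)
    rw [R.sm_zero] at t
    linear_combination (norm := abel) t
  real := fun j k i j' k' i' μ ν h => by
    have e := congrArg (R.sm (-ν)) h
    rw [map_add, map_add, map_zero, ← R.sm_add, ← R.sm_add, neg_add_cancel, R.sm_zero] at e
    have e' : R.a i' j' + R.sm (-ν) (R.b j k) + R.sm (-ν + μ) (R.d k' i) = 0 := by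
      linear_combination (norm := abel) e
    obtain ⟨h1, h2, h3⟩ := R.real i' j' k i j k' _ _ e'
    exact ⟨h2.symm, h3, h1.symm⟩

/-- `rotate` keeps the action. -/
@[simp] theorem rotate_sm : R.rotate.sm = R.sm := rfl
/-- `rotate`: new `a` is `b`. -/
@[simp] theorem rotate_a : R.rotate.a = R.b := rfl
/-- `rotate`: new `b` is `d`. -/
@[simp] theorem rotate_b : R.rotate.b = R.d := rfl
/-- `rotate`: new `d` is `a`. -/
@[simp] theorem rotate_d : R.rotate.d = R.a := rfl
/-- `rotate`: new `φ` is `ψ - φ` (indices rotated). -/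
@[simp] theorem rotate_φ (j : J) (k : K) (i : I) : R.rotate.φ j k i = R.ψ i j k - R.φ i j k := rfl
/-- `rotate`: new `ψ` is `-φ` (indices rotated). -/
@[simp] theorem rotate_ψ (j : J) (k : K) (i : I) : R.rotate.ψ j k i = -R.φ i j k := rfl

include R in
/-- **Class maps are injective** (Theorem C2, step (0)): `(j,k) ↦ b j k` is injective, hence
`|J|·|K| ≤ |S|`. [this work] -/
theorem card_mul_card_le_card [Nonempty I] [Fintype J] [Fintype K] [Fintype S] :
    Fintype.card J * Fintype.card K ≤ Fintype.card S := by
  obtain ⟨i⟩ := ‹Nonempty I›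
  rw [← Fintype.card_prod]
  refine Fintype.card_le_of_injective (fun p : J × K => R.b p.1 p.2) ?_
  rintro ⟨j, k⟩ ⟨j', k'⟩ (h : R.b j k = R.b j' k')
  have e := R.eqn i j k
  rw [h] at e
  obtain ⟨-, h2, h3⟩ := R.real i j k' i j' k _ _ e
  rw [h2, h3]

/-- **The five-term lemma** (Theorem C2, step (2)). If the multiplier group acts fixed-point-freely,
then for every rectangle `{i,i'} × {k,k'}` at most `|A|⁵` slices `j` have non-zero `φ`-holonomy.
[this work] -/
theorem card_bad_slices_le [Fintype A] [DecidableEq A] [Fintype J]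
    (hfpf : ∀ g : A, g ≠ 0 → ∀ x : S, R.sm g x = x → x = 0) (i i' : I) (k k' : K) :
    (Finset.univ.filter fun j =>
        R.φ i j k - R.φ i j k' - R.φ i' j k + R.φ i' j k' ≠ 0).card ≤ Fintype.card A ^ 5 := by
  -- the key `j ↦ (hol, μ₁, μ₂, μ₃, μ₄)`
  let key : J → A × A × A × A × A := fun j =>
    (R.φ i j k - R.φ i j k' - R.φ i' j k + R.φ i' j k', R.ψ i j k - R.φ i j k',
      R.ψ i j k' - R.φ i j k', R.φ i j k - R.φ i' j k - R.φ i j k' + R.ψ i' j k,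
      R.φ i j k - R.φ i' j k - R.φ i j k' + R.ψ i' j k')
  -- the five-term identity
  have fiveterm : ∀ j, R.sm (R.φ i j k - R.φ i j k' - R.φ i' j k + R.φ i' j k') (R.b j k') - R.b j k'
      = -R.sm (R.ψ i j k - R.φ i j k') (R.d k i) + R.sm (R.ψ i j k' - R.φ i j k') (R.d k' i)
        + R.sm (R.φ i j k - R.φ i' j k - R.φ i j k' + R.ψ i' j k) (R.d k i')
        - R.sm (R.φ i j k - R.φ i' j k - R.φ i j k' + R.ψ i' j k') (R.d k' i') := by
    intro j
    have e1 := R.transport (-R.φ i j k') i j k (R.φ i j k - R.φ i j k') (R.ψ i j k - R.φ i j k')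
      (by abel) (by abel)
    have e2 := R.transport (-R.φ i j k') i j k' 0 (R.ψ i j k' - R.φ i j k') (by abel) (by abel)
    rw [R.sm_zero] at e2
    have e3 := R.transport (R.φ i j k - R.φ i' j k - R.φ i j k') i' j k (R.φ i j k - R.φ i j k')
      (R.φ i j k - R.φ i' j k - R.φ i j k' + R.ψ i' j k) (by abel) (by abel)
    have e4 := R.transport (R.φ i j k - R.φ i' j k - R.φ i j k') i' j k'
      (R.φ i j k - R.φ i j k' - R.φ i' j k + R.φ i' j k')
      (R.φ i j k - R.φ i' j k - R.φ i j k' + R.ψ i' j k') (by abel) (by abel)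
    linear_combination (norm := abel) e1 - e2 - e3 + e4
  -- the key is injective on bad slices
  have hinj : Set.InjOn key ↑(Finset.univ.filter fun j =>
      R.φ i j k - R.φ i j k' - R.φ i' j k + R.φ i' j k' ≠ 0) := by
    intro j hj j₂ hj₂ hkey
    simp only [Finset.coe_filter, Finset.mem_univ, true_and, Set.mem_setOf_eq] at hj hj₂
    simp only [key, Prod.mk.injEq] at hkey
    obtain ⟨h0, h1, h2, h3, h4⟩ := hkey
    have t1 := fiveterm j
    have t2 := fiveterm j₂
    rw [h0, h1, h2, h3, h4] at t1
    have hdiff : R.sm (R.φ i j₂ k - R.φ i j₂ k' - R.φ i' j₂ k + R.φ i' j₂ k') (R.b j k' - R.b j₂ k')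
        = R.b j k' - R.b j₂ k' := by
      rw [map_sub]; linear_combination (norm := abel) t1 - t2
    have hb : R.b j k' = R.b j₂ k' := sub_eq_zero.mp (hfpf _ hj₂ _ hdiff)
    have e := R.eqn i j₂ k'
    rw [← hb] at e
    exact (R.real i j₂ k' i j k' _ _ e).2.1
  have hmaps : Set.MapsTo key
      ↑(Finset.univ.filter fun j => R.φ i j k - R.φ i j k' - R.φ i' j k + R.φ i' j k' ≠ 0)
      ↑(Finset.univ : Finset (A × A × A × A × A)) := fun _ _ => by simp
  calc _ ≤ (Finset.univ : Finset (A × A × A × A × A)).card :=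
        Finset.card_le_card_of_injOn key hmaps hinj
    _ = Fintype.card A ^ 5 := by simp only [Finset.card_univ, Fintype.card_prod]; ring

/-- Five-term lemma for the `(ψ - φ)`-slices (`k` fixed, rectangles in `I × J`), via `rotate`.
[this work, Thm C2 (2ϑ)] -/
theorem card_bad_slices_le_theta [Fintype A] [DecidableEq A] [Fintype K]
    (hfpf : ∀ g : A, g ≠ 0 → ∀ x : S, R.sm g x = x → x = 0) (i i' : I) (j j' : J) :
    (Finset.univ.filter fun k =>
        (R.ψ i j k - R.φ i j k) - (R.ψ i j' k - R.φ i j' k) - (R.ψ i' j k - R.φ i' j k)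
          + (R.ψ i' j' k - R.φ i' j' k) ≠ 0).card ≤ Fintype.card A ^ 5 := by
  have h := R.rotate.card_bad_slices_le hfpf j j' i i'
  simp only [rotate_φ] at h
  convert h using 3 with k
  -- the two holonomy expressions differ by the order of the middle terms
  have : R.ψ i j k - R.φ i j k - (R.ψ i j' k - R.φ i j' k) - (R.ψ i' j k - R.φ i' j k)
      + (R.ψ i' j' k - R.φ i' j' k) = R.ψ i j k - R.φ i j k - (R.ψ i' j k - R.φ i' j k)
      - (R.ψ i j' k - R.φ i j' k) + (R.ψ i' j' k - R.φ i' j' k) := by abel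
  rw [this]

/-- Five-term lemma for the `ψ`-slices (`i` fixed, rectangles in `J × K`), via `rotate ∘ rotate`.
[this work, Thm C2 (2ψ)] -/
theorem card_bad_slices_le_psi [Fintype A] [DecidableEq A] [Fintype I]
    (hfpf : ∀ g : A, g ≠ 0 → ∀ x : S, R.sm g x = x → x = 0) (j j' : J) (k k' : K) :
    (Finset.univ.filter fun i =>
        R.ψ i j k - R.ψ i j k' - R.ψ i j' k + R.ψ i j' k' ≠ 0).card ≤ Fintype.card A ^ 5 := by
  have h := R.rotate.rotate.card_bad_slices_le hfpf k k' j j'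
  simp only [rotate_φ, rotate_ψ] at h
  convert h using 3 with i
  have : -R.φ i j k - (R.ψ i j k - R.φ i j k) - (-R.φ i j' k - (R.ψ i j' k - R.φ i j' k))
      - (-R.φ i j k' - (R.ψ i j k' - R.φ i j k')) + (-R.φ i j' k' - (R.ψ i j' k' - R.φ i j' k'))
      = -(R.ψ i j k - R.ψ i j k' - R.ψ i j' k + R.ψ i j' k') := by abel
  rw [this, neg_ne_zero]

end TwistedRealization

end Summit.MatrixMultiplication.MatrixMultiplication.Theorems.TwistedTPP
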